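import Literature.Analysis.FluidPDE.HomogeneousEuler
import Literature.Analysis.FluidPDE.AxisymmetricEuler
import HarnessLib

/-!
# No `C²` axisymmetric homogeneous stationary Euler flows of degree `-α`, `0 < α < 2` (Shvydkoy 2018, Prop. 5.1)

R. Shvydkoy, *Homogeneous solutions to the 3D Euler system*, Trans. Amer. Math. Soc. 370 (2018)
2517–2535 = arXiv:1510.03378 [`Shvydkoy2018`], §5 "Axisymmetric solutions" (arXiv p. 11):

* **Proposition 5.1.** "There are no `C²` axisymmetric solutions in the range `0 < α < 2`."
  (With or without swirl. Proof in print: the two conservation laws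
  `|b|^{2-α} |a|^{α-1} sin φ = A` and `|H|^{2-α} |a sin φ|^{2α} = B` of the axisymmetric sphere
  system (5.1)–(5.4) force the Bernoulli function `H = 0` on `S²`; then the solution is
  irrotational (Prop. 3.2) and `α ∈ ℤ ∖ {1}` (Prop. 3.1) — impossible in `(0, 2) ∖ {1}` — while
  `α = 1` carries no `C¹` solutions at all (Prop. 2.1 = the tree's
  `shvydkoy_homogeneousSteadyEuler_alpha_one`).)

Restated (and split into `C²` for `0 ≤ α < 1`, `C¹` for `1 ≤ α ≤ 2`) by K. Abe, *Existence of
homogeneous Euler flows of degree `-α ∉ [-2,0]`*, Arch. Ration. Mech. Anal. 248 (2024) =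
arXiv:2305.05987, Thm 1.5 (i)–(ii) and p. 3, Case 3 (B).

## Why it is here

Nearest rigidity prior art (NOT a match) for the route item
`Summit.AnomalousDissipation.AnomalousDissipation.Theses.PointSink.PointFluxCone`
(stmt-AnomalousDissipation-19033), which asks for a discretely self-similar WEAK stationary Euler
pair on `ℝ³ ∖ {0}` of degrees `(-2/3, -4/3)` with NON-ZERO radial energy flux through the
fundamental shell.  At the Onsager-critical degree `α = 2/3 ∈ (0, 2)` the proposition says that a
fully homogeneous axisymmetric witness cannot be `C²` off the origin; together with Lemma 6.1 of the
same paper (`shvydkoy2018_lemma61_sphereMoments`, `HomogeneousEulerFlux.lean`: smooth homogeneous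
profiles of any symmetry are fluxless) it pins that item's witnesses to genuinely rough or merely
discretely self-similar profiles, as its docstring anticipates ("nor axisymmetric with power-law
poles").  Vendored as a hypothesis for refuters/provers of that item (and of the axisymmetric
sub-crux its route foresees); it decides nothing about rough profiles.

## Rendering

"`C²` axisymmetric solution" = the tree's `C¹` class `IsHomogeneousSteadyEuler α V P`
(`HomogeneousEuler.lean`: homogeneity of degrees `-α`, `-2α` under ALL dilations `x ↦ c x`,
`c > 0`, `div V = 0` and `V·∇V + ∇P = 0` classically off the origin) plus `C²` regularity of `V`
and `P` on `ℝ³ ∖ {0}` ("`a, b, f, p ∈ C²(S²)`" in bulk variables, poles included — p. 11: "in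
order for a solution to remain smooth at the pole we necessarily have
`a(0) = a(π) = b(0) = b(π) = 0`"), plus axisymmetry of `V` (equivariance under the rotations
about the `x 2`-axis, `IsAxisymmetric`) and of `P` (`IsAxisymmetricScalar`; automatic from the
momentum equation and homogeneity, kept because the printed ansatz takes all of `a, b, f, p`
functions of the polar angle only) — both from `AxisymmetricEuler.lean`; by rotation invariance of
the Euler system the choice of axis is immaterial.  "No solutions" means no non-trivial ones
(`IsHomogeneousSteadyEuler.zero` solves the system in every degree): the conclusion is `V = 0`
off the origin (then also `P = 0` there, `IsHomogeneousSteadyEuler.pressure_eq_zero_of_velocity_eq_zero`,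
as `α ≠ 0`).

* `shvydkoy2018_prop51_noAxisymmetric` — NAMED FACT (Prop. 5.1), a `def … : Prop`, no `sorry`;
  users take `(h : shvydkoy2018_prop51_noAxisymmetric)`.
* `shvydkoy2018_prop51_noAxisymmetric.twoThirds` — proved specialisation to the Onsager-critical
  degree `α = 2/3` of the route item (velocity and pressure both vanish off the origin).

## References

* R. Shvydkoy, Trans. Amer. Math. Soc. 370 (2018) 2517–2535, doi:10.1090/tran/7022 =
  arXiv:1510.03378, §5, Prop. 5.1 (with Props. 2.1, 3.1, 3.2). [`Shvydkoy2018`]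
* K. Abe, Arch. Ration. Mech. Anal. 248 (2024), doi:10.1007/s00205-024-01974-0 =
  arXiv:2305.05987, Thm 1.5 (i)–(ii), p. 3 Case 3.
-/

noncomputable section

open Set

namespace Literature.Analysis.FluidPDE

/-- **Shvydkoy 2018, Proposition 5.1** (Trans. AMS 370 (2018), §5 = arXiv:1510.03378 p. 11):
"There are no `C²` axisymmetric solutions in the range `0 < α < 2`."  Here a solution is a
stationary Euler pair `(V, P)` on `ℝ³ ∖ {0}`, homogeneous of degrees `-α` (velocity) and `-2α`
(pressure) under all dilations, `V·∇V + ∇P = 0`, `div V = 0` (Shvydkoy (1)–(2)), axisymmetric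
about a fixed axis with or without swirl, of class `C²` off the origin; "no solutions" = only the
trivial one, `V = 0` off the origin.  Restated as Abe 2024 (ARMA 248 = arXiv:2305.05987),
Thm 1.5 (i)–(ii) / p. 3 Case 3 (B).  At `α = 2/3` it excludes `C²` axisymmetric fully homogeneous
witnesses for — grounds, as nearest rigidity prior art, not a match —
`Summit.AnomalousDissipation.AnomalousDissipation.Theses.PointSink.PointFluxCone`.
[cite: Shvydkoy2018, Prop 5.1] -/
def shvydkoy2018_prop51_noAxisymmetric : Prop :=
  ∀ ⦃α : ℝ⦄, 0 < α → α < 2 →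
    ∀ ⦃V : EuclideanSpace ℝ (Fin 3) → EuclideanSpace ℝ (Fin 3)⦄ ⦃P : EuclideanSpace ℝ (Fin 3) → ℝ⦄,
      IsHomogeneousSteadyEuler α V P →
      ContDiffOn ℝ 2 V {x | x ≠ 0} → ContDiffOn ℝ 2 P {x | x ≠ 0} →
      IsAxisymmetric V → IsAxisymmetricScalar P →
        ∀ x, x ≠ 0 → V x = 0

/-- The Onsager-critical case `α = 2/3` of Shvydkoy's Prop. 5.1: a `C²` axisymmetric homogeneous
stationary Euler flow of degree `-2/3` off the origin is trivial — velocity AND pressure vanish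
off the origin (the pressure by `IsHomogeneousSteadyEuler.pressure_eq_zero_of_velocity_eq_zero`,
`α = 2/3 ≠ 0`). [cite: Shvydkoy2018, Prop 5.1] -/
theorem shvydkoy2018_prop51_noAxisymmetric.twoThirds (h : shvydkoy2018_prop51_noAxisymmetric)
    {V : EuclideanSpace ℝ (Fin 3) → EuclideanSpace ℝ (Fin 3)} {P : EuclideanSpace ℝ (Fin 3) → ℝ}
    (hVP : IsHomogeneousSteadyEuler (2 / 3) V P)
    (hV : ContDiffOn ℝ 2 V {x | x ≠ 0}) (hP : ContDiffOn ℝ 2 P {x | x ≠ 0})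
    (hax : IsAxisymmetric V) (haxP : IsAxisymmetricScalar P) :
    (∀ x, x ≠ 0 → V x = 0) ∧ ∀ x, x ≠ 0 → P x = 0 := by
  have hV0 : ∀ x, x ≠ 0 → V x = 0 := h (by norm_num) (by norm_num) hVP hV hP hax haxP
  refine ⟨hV0, fun x hx => ?_⟩
  exact hVP.pressure_eq_zero_of_velocity_eq_zero (by norm_num) (fun y hy => hV0 y hy) hx

end Literature.Analysis.FluidPDE
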